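import Summits.QuantumFields.BalabanUV.Beta.GAN24.Push3
import Summits.QuantumFields.BalabanUV.Beta.GAN24.EnvelopeBlockSum

/-!
# `BalabanUV.Beta.GAN24.Push3LegTelescope` — binder row G-an2-4 / (CONV-C), the row owner's CONTACT-TERM ROUTE (`HOME/b2b-balaban-gan24-p1/gen17/CT-ROUTE-v1.md`
# §3, `gen18/CT3-MECHANISM.md` v1.1 §(c)), module CT-3c §1: THE THREE-LEG PUSH `Push3.push₃ l r w S` IS ADDITIVE IN EACH OF ITS THREE LEG FAMILIES ON
# THE SUMMABLE CLASS, and the ONE-LEG-AT-A-TIME TELESCOPING IDENTITY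
# `push₃ lᴱ rᴱ wᴱ S − push₃ lᴮ rᴮ wᴮ S = push₃ (lᴱ − lᴮ) rᴱ wᴱ S + push₃ lᴮ (rᴱ − rᴮ) wᴱ S + push₃ lᴮ rᴮ (wᴱ − wᴮ) S`.

NOT IN PRINT; OUR BOOKKEEPING (G-an2-4 formalisation swarm, leaf prover `b2b-balaban-gan24-formalise-leaf-01`, gen 58; the row owner gan24-p1-g18's invitation
`HOME/INBOX.md` 2026-08-21T12:47Z «CT-3c (assembly) = telescoping one leg at a time at the `push₃` level (leaf-01's `Push3`) … say MINE with the `push₃`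
leg-additivity on the summable class as §1»; journal `CLAIMS.log` l.31499; names PROVISIONAL — the owner may rename / re-cut).  HONEST FRAMING (cell contract,
verbatim): «discharging `BetaPertH` makes Bałaban's UV stability UNCONDITIONAL — a real constructive-QFT result; it is NOT the continuum limit and NOT the Clay
problem.»  HONEST DEPENDENCY (verbatim): «continuum YM on T⁴ ⇐ BetaPertH ∧ nine spine estimates (0/9 proved); BetaPertH ⇐ (D1) ∧ (D4) ∧ CAP+tail; G-an2-4
gates asym, D1 and NE2/3/4.»

WHAT.  `Push3` (leaf-01 g43) typed `push₃ l r w S κ′ u′ := ffRead (Lk l ∘ vertexW w S κ′ u′ ∘ Rk r)` and its linearity IN THE TABLE `S`.  The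
contact-term route compares the cubic read-out through the DRESSED composite legs `(lᴱ, rᴱ, wᴱ)` (leaf-03's `legChain (respStepBmSeq ρ Lc)`; an2's
`T^E = Π T^B + dz λ`, leaf-01 g57's `DressedLegUnits.legAct_legChain_eq_add_dz`) with the one through the UNDRESSED legs `(lᴮ, rᴮ, wᴮ)`, ONE LEG AT A TIME
(CT3-MECHANISM v1.1 §(c)).  This module is the linearity IN THE LEG FAMILIES that this needs, on the weakest natural class (NO `LegDecay` currency — the
owner's re-cut word (iii), journal l.31094): §1 pointwise `Lk_sub∕smul`, `Rk_sub∕smul`, `vertexW_smul_leg`, `vertexW_sub_leg` (BOUNDED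
table legs, SUMMABLE table slices); §2 homogeneity `push₃_smul_left∕right∕table`, `push₃_neg_*` (hypothesis-free); §3 **ADDITIVITY ON THE SUMMABLE CLASS**
(left legs BOUNDED with SUMMABLE fine rows, right legs with SUMMABLE fine columns, table legs BOUNDED, table `LocStencil S Cs δ`, `0 < δ`):
`push₃_sub_left∕right∕table` (+ `_add_*`) — the `tsum`s split under «summable leg × bounded vertex» and «bounded `Lk l ∘ vertexW` × summable leg»
(`Push4NestAux.decays_vertexW_of_locStencil`, `abs_comp_Lk_le_of_decays`, `summable_Lk_row∕Rk_col`; `KernelWard.comp_sub_left∕right`); §4 **THE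
TELESCOPING IDENTITY** `push₃_telescope` (term 1 both partners dressed, term 2 mixed, term 3 both undressed — the order of §(c)), the reverse order
`push₃_telescope'`, and the full multilinear expansion `push₃_sub_eq_multilinear` (CT-ROUTE v1 §3's «terms with ≥ 1 pure-gauge leg»); §5 the class from
BLOCK ENVELOPES (leaf-12's `EnvelopeBlockSum` currency = leaf-01 g57's `DressedLegEnvelope.exists_legChain_envelope`): `push₃_telescope_of_env`.
[folklore] throughout: dominated-`tsum` bookkeeping over leaf-17's `Push4` / `Push4NestAux`, leaf-01's `Push3`, leaf-12's `EnvelopeBlockSum` BY NAME; 0 `def`,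
0 cited facts, 0 `def … : Prop`, 0 sorry.  NO estimate; asserts NO shape of Bałaban's stencils; discharges NOTHING of (hS, hSall) on (E); NOT the analysis of
CT-3c (leaf-02's `ContactOneGaugeCell*`, the owner's `Staircase*`); 0 wall binders; NEVER «G-an2-4 closed»; NOT D1, NOT BetaPertH, NOT continuum, NOT Clay.
-/

noncomputable section

open Finset
open scoped BigOperators
open Literature.MathematicalPhysics.QuantumFieldTheory
open Literature.MathematicalPhysics.QuantumFieldTheory.LatticeForm (quo)
open Literature.MathematicalPhysics.QuantumFieldTheory.Balaban1983to89
open Literature.MathematicalPhysics.QuantumFieldTheory.Balaban1983to89.Beta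
open B4ContourShift (supNorm)
open B12Sec2to5 (l1 l1_nonneg)
open ExpKernelCalculus (MKer Decays comp Zl Zl_nonneg)
open OneStepResolventKernel (Fib LocStencil)
open BalabanCompositeJets (summable_slice_of_locStencil)
open KKTFluctuationEnergy (summable_mul_of_bdd summable_mul_of_bdd')
open Summit.QuantumFields.BalabanUV.Beta.GAN24.Push4 (vertexW vertexW_apply Lk Rk ffRead Lk_inl_inl Lk_inl_inr Lk_inr Rk_inl_inl Rk_inr_left
  Rk_inr_right)
open Summit.QuantumFields.BalabanUV.Beta.GAN24.Push4NestAux (decays_vertexW_of_locStencil abs_le_of_decays abs_comp_Lk_le_of_decays summable_Lk_row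
  summable_Rk_col)
open Summit.QuantumFields.BalabanUV.Beta.GAN24.Push3 (push₃ push₃_def ffRead_sub ffRead_smul)
open Summit.QuantumFields.BalabanUV.Beta.GAN24.EnvelopeBlockSum (summable_env env_le_one)

namespace Summit.QuantumFields.BalabanUV.Beta.GAN24.Push3LegTelescope

variable {d : ℕ}
variable {l l' r r' w w' : Fin (d + 1) → (Fin (d + 1) → ℤ) → Fin (d + 1) → (Fin (d + 1) → ℤ) → ℝ}
variable {S : Fin (d + 1) → (Fin (d + 1) → ℤ) → MKer (d + 1) (Fib d)}

/-! ## §1 Pointwise linearity of the leg kernels and of the generalised vertex in its leg family -/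

section Pointwise

variable (l l' r r' w w' S)

/-- [folklore] The left leg kernel is additive in the leg family (pointwise): `Lk (l − l′) = Lk l − Lk l′`. -/
theorem Lk_sub : Lk (l - l') = Lk l - Lk l' := by
  funext x' x a b
  rcases a with α | μ
  · rcases b with κ | ν
    · simp only [Lk_inl_inl, Pi.sub_apply]
    · simp only [Lk_inl_inr, Pi.sub_apply, sub_zero]
  · simp only [Lk_inr, Pi.sub_apply, sub_zero]

/-- [folklore] `Lk (c • l) = c • Lk l`. -/
theorem Lk_smul (c : ℝ) : Lk (c • l) = c • Lk l := by
  funext x' x a b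
  rcases a with α | μ
  · rcases b with κ | ν
    · simp only [Lk_inl_inl, Pi.smul_apply]
    · simp only [Lk_inl_inr, Pi.smul_apply, smul_eq_mul, mul_zero]
  · simp only [Lk_inr, Pi.smul_apply, smul_eq_mul, mul_zero]

/-- [folklore] The right leg kernel is additive in the leg family (pointwise): `Rk (r − r′) = Rk r − Rk r′`. -/
theorem Rk_sub : Rk (r - r') = Rk r - Rk r' := by
  funext z z' a b
  rcases a with κ | μ
  · rcases b with β | ν
    · simp only [Rk_inl_inl, Pi.sub_apply]
    · simp only [Rk_inr_right, Pi.sub_apply, sub_zero]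
  · simp only [Rk_inr_left, Pi.sub_apply, sub_zero]

/-- [folklore] `Rk (c • r) = c • Rk r`. -/
theorem Rk_smul (c : ℝ) : Rk (c • r) = c • Rk r := by
  funext z z' a b
  rcases a with κ | μ
  · rcases b with β | ν
    · simp only [Rk_inl_inl, Pi.smul_apply]
    · simp only [Rk_inr_right, Pi.smul_apply, smul_eq_mul, mul_zero]
  · simp only [Rk_inr_left, Pi.smul_apply, smul_eq_mul, mul_zero]

/-- [folklore] The generalised vertex is homogeneous in its leg family (hypothesis-free): `vertexW (c • w) S κ′ u′ = c • vertexW w S κ′ u′`. -/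
theorem vertexW_smul_leg (c : ℝ) (κ' : Fin (d + 1)) (u' : Fin (d + 1) → ℤ) : vertexW (c • w) S κ' u' = c • vertexW w S κ' u' := by
  funext x z a b
  simp only [vertexW_apply, Pi.smul_apply, smul_eq_mul, Finset.mul_sum]
  refine Finset.sum_congr rfl fun κ _ => ?_
  rw [← tsum_mul_left]
  exact tsum_congr fun u => by ring

variable {w w' S}

/-- [folklore] **THE GENERALISED VERTEX IS ADDITIVE IN ITS LEG FAMILY** for BOUNDED leg weights and a table with SUMMABLE slices (`tsum_sub`):
`vertexW (w − w′) S κ′ u′ = vertexW w S κ′ u′ − vertexW w′ S κ′ u′`. -/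
theorem vertexW_sub_leg {Cw Cw' : ℝ} (hw : ∀ κ' u' κ u, |w κ' u' κ u| ≤ Cw) (hw' : ∀ κ' u' κ u, |w' κ' u' κ u| ≤ Cw')
    (hS : ∀ κ x z a b, Summable fun u => S κ u x z a b) (κ' : Fin (d + 1)) (u' : Fin (d + 1) → ℤ) :
    vertexW (w - w') S κ' u' = vertexW w S κ' u' - vertexW w' S κ' u' := by
  funext x z a b
  simp only [vertexW_apply, Pi.sub_apply, ← Finset.sum_sub_distrib]
  refine Finset.sum_congr rfl fun κ _ => ?_
  rw [← (summable_mul_of_bdd (fun u => hw κ' u' κ u) (hS κ x z a b)).tsum_sub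
    (summable_mul_of_bdd (fun u => hw' κ' u' κ u) (hS κ x z a b))]
  exact tsum_congr fun u => by ring

end Pointwise

/-! ## §2 Homogeneity of the push in each leg family (hypothesis-free) -/

section Smul

variable (l r w S)

/-- [folklore] `push₃ (c • l) r w S κ′ u′ = c • push₃ l r w S κ′ u′` (no hypothesis). -/
theorem push₃_smul_left (c : ℝ) (κ' : Fin (d + 1)) (u' : Fin (d + 1) → ℤ) :
    push₃ (c • l) r w S κ' u' = c • push₃ l r w S κ' u' := by
  rw [push₃_def, push₃_def, Lk_smul, KernelReflection.comp_smul_left, KernelReflection.comp_smul_left, ffRead_smul]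

/-- [folklore] `push₃ l (c • r) w S κ′ u′ = c • push₃ l r w S κ′ u′` (no hypothesis). -/
theorem push₃_smul_right (c : ℝ) (κ' : Fin (d + 1)) (u' : Fin (d + 1) → ℤ) :
    push₃ l (c • r) w S κ' u' = c • push₃ l r w S κ' u' := by
  rw [push₃_def, push₃_def, Rk_smul, KernelReflection.comp_smul_right, ffRead_smul]

/-- [folklore] `push₃ l r (c • w) S κ′ u′ = c • push₃ l r w S κ′ u′` (no hypothesis). -/
theorem push₃_smul_table (c : ℝ) (κ' : Fin (d + 1)) (u' : Fin (d + 1) → ℤ) :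
    push₃ l r (c • w) S κ' u' = c • push₃ l r w S κ' u' := by
  rw [push₃_def, push₃_def, vertexW_smul_leg, KernelReflection.comp_smul_right, KernelReflection.comp_smul_left, ffRead_smul]

/-- [folklore] `push₃ (−l) r w S κ′ u′ = −push₃ l r w S κ′ u′`. -/
theorem push₃_neg_left (κ' : Fin (d + 1)) (u' : Fin (d + 1) → ℤ) : push₃ (-l) r w S κ' u' = -push₃ l r w S κ' u' := by
  have h := push₃_smul_left l r w S (-1) κ' u'
  simp only [neg_one_smul] at h
  exact h

/-- [folklore] `push₃ l (−r) w S κ′ u′ = −push₃ l r w S κ′ u′`. -/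
theorem push₃_neg_right (κ' : Fin (d + 1)) (u' : Fin (d + 1) → ℤ) : push₃ l (-r) w S κ' u' = -push₃ l r w S κ' u' := by
  have h := push₃_smul_right l r w S (-1) κ' u'
  simp only [neg_one_smul] at h
  exact h

/-- [folklore] `push₃ l r (−w) S κ′ u′ = −push₃ l r w S κ′ u′`. -/
theorem push₃_neg_table (κ' : Fin (d + 1)) (u' : Fin (d + 1) → ℤ) : push₃ l r (-w) S κ' u' = -push₃ l r w S κ' u' := by
  have h := push₃_smul_table l r w S (-1) κ' u'
  simp only [neg_one_smul] at h
  exact h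

end Smul

/-! ## §3 Additivity of the push in each leg family ON THE SUMMABLE CLASS -/

section SummableClass

variable {Cl Cl' Cw Cw' Cs δ : ℝ}

/-- [folklore] (bookkeeping) The rows of a left leg kernel with SUMMABLE fine rows are summable against any BOUNDED kernel. -/
theorem summable_Lk_mul_of_bdd (hls : ∀ α x' κ, Summable fun x => l α x' κ x) {V : MKer (d + 1) (Fib d)} {CV : ℝ}
    (hVb : ∀ y z f b, |V y z f b| ≤ CV) (x z : Fin (d + 1) → ℤ) (a b : Fib d) :
    Summable fun y : Fin (d + 1) → ℤ => ∑ f, Lk l x y a f * V y z f b :=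
  summable_sum fun f _ => summable_mul_of_bdd' (summable_Lk_row hls x a f) (fun y => hVb y z f b)

/-- [folklore] (bookkeeping) A BOUNDED kernel is summable against the columns of a right leg kernel with SUMMABLE fine columns. -/
theorem summable_mul_Rk_of_bdd {M : MKer (d + 1) (Fib d)} {CM : ℝ} (hMb : ∀ x y a g, |M x y a g| ≤ CM)
    (hrs : ∀ β z' κ, Summable fun z => r β z' κ z) (x z : Fin (d + 1) → ℤ) (a b : Fib d) :
    Summable fun y : Fin (d + 1) → ℤ => ∑ g, M x y a g * Rk r y z g b :=
  summable_sum fun g _ => summable_mul_of_bdd (fun y => hMb x y a g) (summable_Rk_col hrs z g b)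

/-- [folklore] (bookkeeping) The table vertex through BOUNDED table legs of a `LocStencil` table at a positive rate is BOUNDED, by
`(d+1)·(C_w·Cs·Zl(δ/2))`. -/
theorem abs_vertexW_le (hw : ∀ κ' u' κ u, |w κ' u' κ u| ≤ Cw) (hS : LocStencil S Cs δ) (hδ : 0 < δ) (κ' : Fin (d + 1))
    (u' : Fin (d + 1) → ℤ) (y z : Fin (d + 1) → ℤ) (f b : Fib d) :
    |vertexW w S κ' u' y z f b| ≤ (d + 1 : ℕ) * (Cw * Cs * Zl (d + 1) (δ / 2)) :=
  abs_le_of_decays (decays_vertexW_of_locStencil hw ((abs_nonneg _).trans (hw 0 0 0 0)) hS hδ κ' u') (half_pos hδ).le y z f b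

/-- [folklore] (bookkeeping) The left leg kernel of BOUNDED legs against the table vertex (BOUNDED table legs, `LocStencil` table, `δ > 0`) is BOUNDED, by
`(d+1)·(C_l·[(d+1)·(C_w·Cs·Zl(δ/2))]·Zl(δ/2))`. -/
theorem abs_comp_Lk_vertexW_le (hl : ∀ α x' κ x, |l α x' κ x| ≤ Cl) (hw : ∀ κ' u' κ u, |w κ' u' κ u| ≤ Cw) (hS : LocStencil S Cs δ)
    (hδ : 0 < δ) (κ' : Fin (d + 1)) (u' : Fin (d + 1) → ℤ) (x y : Fin (d + 1) → ℤ) (a g : Fib d) :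
    |comp (Lk l) (vertexW w S κ' u') x y a g| ≤ (d + 1 : ℕ) * (Cl * ((d + 1 : ℕ) * (Cw * Cs * Zl (d + 1) (δ / 2))) * Zl (d + 1) (δ / 2)) :=
  abs_comp_Lk_le_of_decays hl ((abs_nonneg _).trans (hl 0 0 0 0))
    (decays_vertexW_of_locStencil hw ((abs_nonneg _).trans (hw 0 0 0 0)) hS hδ κ' u') (half_pos hδ) x y a g

/-- [folklore] **`push₃` IS ADDITIVE IN THE LEFT LEG FAMILY ON THE SUMMABLE CLASS — DIFFERENCE FORM**: left legs `l, l′` BOUNDED with SUMMABLE fine rows,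
right legs `r` with SUMMABLE fine columns, table legs `w` BOUNDED, table `LocStencil S Cs δ` with `0 < δ` ⟹
`push₃ (l − l′) r w S κ′ u′ = push₃ l r w S κ′ u′ − push₃ l′ r w S κ′ u′`. -/
theorem push₃_sub_left (hl : ∀ α x' κ x, |l α x' κ x| ≤ Cl) (hls : ∀ α x' κ, Summable fun x => l α x' κ x)
    (hl' : ∀ α x' κ x, |l' α x' κ x| ≤ Cl') (hl's : ∀ α x' κ, Summable fun x => l' α x' κ x)
    (hrs : ∀ β z' κ, Summable fun z => r β z' κ z) (hw : ∀ κ' u' κ u, |w κ' u' κ u| ≤ Cw) (hS : LocStencil S Cs δ) (hδ : 0 < δ)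
    (κ' : Fin (d + 1)) (u' : Fin (d + 1) → ℤ) :
    push₃ (l - l') r w S κ' u' = push₃ l r w S κ' u' - push₃ l' r w S κ' u' := by
  have hVb := abs_vertexW_le hw hS hδ κ' u'
  rw [push₃_def, push₃_def, push₃_def, Lk_sub,
    KernelWard.comp_sub_left (summable_Lk_mul_of_bdd hls hVb) (summable_Lk_mul_of_bdd hl's hVb),
    KernelWard.comp_sub_left (summable_mul_Rk_of_bdd (abs_comp_Lk_vertexW_le hl hw hS hδ κ' u') hrs)
      (summable_mul_Rk_of_bdd (abs_comp_Lk_vertexW_le hl' hw hS hδ κ' u') hrs),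
    ffRead_sub]

/-- [folklore] The same, additive form: `push₃ (l + l′) r w S κ′ u′ = push₃ l r w S κ′ u′ + push₃ l′ r w S κ′ u′`. -/
theorem push₃_add_left (hl : ∀ α x' κ x, |l α x' κ x| ≤ Cl) (hls : ∀ α x' κ, Summable fun x => l α x' κ x)
    (hl' : ∀ α x' κ x, |l' α x' κ x| ≤ Cl') (hl's : ∀ α x' κ, Summable fun x => l' α x' κ x)
    (hrs : ∀ β z' κ, Summable fun z => r β z' κ z) (hw : ∀ κ' u' κ u, |w κ' u' κ u| ≤ Cw) (hS : LocStencil S Cs δ) (hδ : 0 < δ)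
    (κ' : Fin (d + 1)) (u' : Fin (d + 1) → ℤ) :
    push₃ (l + l') r w S κ' u' = push₃ l r w S κ' u' + push₃ l' r w S κ' u' := by
  have e : l + l' = l - (-l') := by rw [sub_neg_eq_add]
  have hnl' : ∀ α x' κ x, |(-l') α x' κ x| ≤ Cl' := fun α x' κ x => by
    rw [Pi.neg_apply, Pi.neg_apply, Pi.neg_apply, Pi.neg_apply, abs_neg]; exact hl' α x' κ x
  have hnl's : ∀ α x' κ, Summable fun x => (-l') α x' κ x := fun α x' κ =>
    (hl's α x' κ).neg.congr fun x => by simp only [Pi.neg_apply]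
  rw [e, push₃_sub_left hl hls hnl' hnl's hrs hw hS hδ κ' u', push₃_neg_left, sub_neg_eq_add]

/-- [folklore] **`push₃` IS ADDITIVE IN THE RIGHT LEG FAMILY ON THE SUMMABLE CLASS — DIFFERENCE FORM**: left legs `l` BOUNDED with SUMMABLE fine rows,
right legs `r, r′` with SUMMABLE fine columns, table legs `w` BOUNDED, table `LocStencil S Cs δ`, `0 < δ` ⟹
`push₃ l (r − r′) w S κ′ u′ = push₃ l r w S κ′ u′ − push₃ l r′ w S κ′ u′`.  (The summability of `l`'s rows is not used here: the bound on
`Lk l ∘ vertexW` needs only `|l| ≤ C_l`.) -/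
theorem push₃_sub_right (hl : ∀ α x' κ x, |l α x' κ x| ≤ Cl)
    (hrs : ∀ β z' κ, Summable fun z => r β z' κ z) (hr's : ∀ β z' κ, Summable fun z => r' β z' κ z)
    (hw : ∀ κ' u' κ u, |w κ' u' κ u| ≤ Cw) (hS : LocStencil S Cs δ) (hδ : 0 < δ) (κ' : Fin (d + 1)) (u' : Fin (d + 1) → ℤ) :
    push₃ l (r - r') w S κ' u' = push₃ l r w S κ' u' - push₃ l r' w S κ' u' := by
  rw [push₃_def, push₃_def, push₃_def, Rk_sub,
    KernelWard.comp_sub_right (summable_mul_Rk_of_bdd (abs_comp_Lk_vertexW_le hl hw hS hδ κ' u') hrs)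
      (summable_mul_Rk_of_bdd (abs_comp_Lk_vertexW_le hl hw hS hδ κ' u') hr's),
    ffRead_sub]

/-- [folklore] The same, additive form: `push₃ l (r + r′) w S κ′ u′ = push₃ l r w S κ′ u′ + push₃ l r′ w S κ′ u′`. -/
theorem push₃_add_right (hl : ∀ α x' κ x, |l α x' κ x| ≤ Cl)
    (hrs : ∀ β z' κ, Summable fun z => r β z' κ z) (hr's : ∀ β z' κ, Summable fun z => r' β z' κ z)
    (hw : ∀ κ' u' κ u, |w κ' u' κ u| ≤ Cw) (hS : LocStencil S Cs δ) (hδ : 0 < δ) (κ' : Fin (d + 1)) (u' : Fin (d + 1) → ℤ) :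
    push₃ l (r + r') w S κ' u' = push₃ l r w S κ' u' + push₃ l r' w S κ' u' := by
  have e : r + r' = r - (-r') := by rw [sub_neg_eq_add]
  have hnr's : ∀ β z' κ, Summable fun z => (-r') β z' κ z := fun β z' κ =>
    (hr's β z' κ).neg.congr fun z => by simp only [Pi.neg_apply]
  rw [e, push₃_sub_right hl hrs hnr's hw hS hδ κ' u', push₃_neg_right, sub_neg_eq_add]

/-- [folklore] **`push₃` IS ADDITIVE IN THE TABLE LEG FAMILY ON THE SUMMABLE CLASS — DIFFERENCE FORM**: left legs `l` BOUNDED with SUMMABLE fine rows,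
right legs `r` with SUMMABLE fine columns, table legs `w, w′` BOUNDED, table `LocStencil S Cs δ`, `0 < δ` ⟹
`push₃ l r (w − w′) S κ′ u′ = push₃ l r w S κ′ u′ − push₃ l r w′ S κ′ u′`. -/
theorem push₃_sub_table (hl : ∀ α x' κ x, |l α x' κ x| ≤ Cl) (hls : ∀ α x' κ, Summable fun x => l α x' κ x)
    (hrs : ∀ β z' κ, Summable fun z => r β z' κ z) (hw : ∀ κ' u' κ u, |w κ' u' κ u| ≤ Cw) (hw' : ∀ κ' u' κ u, |w' κ' u' κ u| ≤ Cw')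
    (hS : LocStencil S Cs δ) (hδ : 0 < δ) (κ' : Fin (d + 1)) (u' : Fin (d + 1) → ℤ) :
    push₃ l r (w - w') S κ' u' = push₃ l r w S κ' u' - push₃ l r w' S κ' u' := by
  rw [push₃_def, push₃_def, push₃_def, vertexW_sub_leg hw hw' (fun κ x z a b => summable_slice_of_locStencil hS hδ κ x z a b) κ' u',
    KernelWard.comp_sub_right (summable_Lk_mul_of_bdd hls (abs_vertexW_le hw hS hδ κ' u'))
      (summable_Lk_mul_of_bdd hls (abs_vertexW_le hw' hS hδ κ' u')),
    KernelWard.comp_sub_left (summable_mul_Rk_of_bdd (abs_comp_Lk_vertexW_le hl hw hS hδ κ' u') hrs)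
      (summable_mul_Rk_of_bdd (abs_comp_Lk_vertexW_le hl hw' hS hδ κ' u') hrs),
    ffRead_sub]

/-- [folklore] The same, additive form: `push₃ l r (w + w′) S κ′ u′ = push₃ l r w S κ′ u′ + push₃ l r w′ S κ′ u′`. -/
theorem push₃_add_table (hl : ∀ α x' κ x, |l α x' κ x| ≤ Cl) (hls : ∀ α x' κ, Summable fun x => l α x' κ x)
    (hrs : ∀ β z' κ, Summable fun z => r β z' κ z) (hw : ∀ κ' u' κ u, |w κ' u' κ u| ≤ Cw) (hw' : ∀ κ' u' κ u, |w' κ' u' κ u| ≤ Cw')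
    (hS : LocStencil S Cs δ) (hδ : 0 < δ) (κ' : Fin (d + 1)) (u' : Fin (d + 1) → ℤ) :
    push₃ l r (w + w') S κ' u' = push₃ l r w S κ' u' + push₃ l r w' S κ' u' := by
  have e : w + w' = w - (-w') := by rw [sub_neg_eq_add]
  have hnw' : ∀ κ' u' κ u, |(-w') κ' u' κ u| ≤ Cw' := fun κ' u' κ u => by
    rw [Pi.neg_apply, Pi.neg_apply, Pi.neg_apply, Pi.neg_apply, abs_neg]; exact hw' κ' u' κ u
  rw [e, push₃_sub_table hl hls hrs hw hnw' hS hδ κ' u', push₃_neg_table, sub_neg_eq_add]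

/-! ## §4 THE ONE-LEG-AT-A-TIME TELESCOPING IDENTITY -/

variable {lE lB rE rB wE wB : Fin (d + 1) → (Fin (d + 1) → ℤ) → Fin (d + 1) → (Fin (d + 1) → ℤ) → ℝ} {ClE ClB CwE CwB : ℝ}

/-- [folklore] **THE TELESCOPING IDENTITY OF CT-3c** (CT3-MECHANISM v1.1 §(c) «one leg at a time»), on the summable class:
`push₃ lᴱ rᴱ wᴱ S κ′ u′ − push₃ lᴮ rᴮ wᴮ S κ′ u′ = push₃ (lᴱ − lᴮ) rᴱ wᴱ S κ′ u′ + push₃ lᴮ (rᴱ − rᴮ) wᴱ S κ′ u′ + push₃ lᴮ rᴮ (wᴱ − wᴮ) S κ′ u′`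
— term 1: the LEFT leg replaced by the difference family, both partners as in the first reading (dressed); term 2: the RIGHT leg, partners mixed; term 3:
the TABLE leg, both partners as in the second reading (undressed).  In CT-3c each difference family is a pure gauge `dz λ`, so each term is a ONE-gauge
cell (leaf-02's `ContactOneGaugeCell*`). -/
theorem push₃_telescope (hlE : ∀ α x' κ x, |lE α x' κ x| ≤ ClE) (hlEs : ∀ α x' κ, Summable fun x => lE α x' κ x)
    (hlB : ∀ α x' κ x, |lB α x' κ x| ≤ ClB) (hlBs : ∀ α x' κ, Summable fun x => lB α x' κ x)
    (hrEs : ∀ β z' κ, Summable fun z => rE β z' κ z) (hrBs : ∀ β z' κ, Summable fun z => rB β z' κ z)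
    (hwE : ∀ κ' u' κ u, |wE κ' u' κ u| ≤ CwE) (hwB : ∀ κ' u' κ u, |wB κ' u' κ u| ≤ CwB) (hS : LocStencil S Cs δ) (hδ : 0 < δ)
    (κ' : Fin (d + 1)) (u' : Fin (d + 1) → ℤ) :
    push₃ lE rE wE S κ' u' - push₃ lB rB wB S κ' u'
      = push₃ (lE - lB) rE wE S κ' u' + push₃ lB (rE - rB) wE S κ' u' + push₃ lB rB (wE - wB) S κ' u' := by
  rw [push₃_sub_left hlE hlEs hlB hlBs hrEs hwE hS hδ, push₃_sub_right hlB hrEs hrBs hwE hS hδ,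
    push₃_sub_table hlB hlBs hrBs hwE hwB hS hδ]
  abel

/-- [folklore] The telescoping identity in the REVERSE order (table leg first, then right, then left):
`push₃ lᴱ rᴱ wᴱ S − push₃ lᴮ rᴮ wᴮ S = push₃ lᴱ rᴱ (wᴱ − wᴮ) S + push₃ lᴱ (rᴱ − rᴮ) wᴮ S + push₃ (lᴱ − lᴮ) rᴮ wᴮ S`. -/
theorem push₃_telescope' (hlE : ∀ α x' κ x, |lE α x' κ x| ≤ ClE) (hlEs : ∀ α x' κ, Summable fun x => lE α x' κ x)
    (hlB : ∀ α x' κ x, |lB α x' κ x| ≤ ClB) (hlBs : ∀ α x' κ, Summable fun x => lB α x' κ x)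
    (hrEs : ∀ β z' κ, Summable fun z => rE β z' κ z) (hrBs : ∀ β z' κ, Summable fun z => rB β z' κ z)
    (hwE : ∀ κ' u' κ u, |wE κ' u' κ u| ≤ CwE) (hwB : ∀ κ' u' κ u, |wB κ' u' κ u| ≤ CwB) (hS : LocStencil S Cs δ) (hδ : 0 < δ)
    (κ' : Fin (d + 1)) (u' : Fin (d + 1) → ℤ) :
    push₃ lE rE wE S κ' u' - push₃ lB rB wB S κ' u'
      = push₃ lE rE (wE - wB) S κ' u' + push₃ lE (rE - rB) wB S κ' u' + push₃ (lE - lB) rB wB S κ' u' := by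
  rw [push₃_sub_table hlE hlEs hrEs hwE hwB hS hδ, push₃_sub_right hlE hrEs hrBs hwB hS hδ,
    push₃_sub_left hlE hlEs hlB hlBs hrBs hwB hS hδ]
  abel

/-- [folklore] THE FULL MULTILINEAR EXPANSION: `push₃ lᴱ rᴱ wᴱ S − push₃ lᴮ rᴮ wᴮ S` = the three one-difference terms with BOTH partners UNDRESSED
+ the three two-difference cross terms + the three-difference term — CT-ROUTE v1 §3's count «terms with ≥ 1 pure-gauge leg» (the two- and three-gauge
terms being CT-1's `W[dzλ₁, dzλ₂, T] = ¼Q(m_{λ₁}dzλ₂, T)` and `W[dzλ₁, dzλ₂, dzλ₃] = 0`). -/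
theorem push₃_sub_eq_multilinear (hlE : ∀ α x' κ x, |lE α x' κ x| ≤ ClE) (hlEs : ∀ α x' κ, Summable fun x => lE α x' κ x)
    (hlB : ∀ α x' κ x, |lB α x' κ x| ≤ ClB) (hlBs : ∀ α x' κ, Summable fun x => lB α x' κ x)
    (hrEs : ∀ β z' κ, Summable fun z => rE β z' κ z) (hrBs : ∀ β z' κ, Summable fun z => rB β z' κ z)
    (hwE : ∀ κ' u' κ u, |wE κ' u' κ u| ≤ CwE) (hwB : ∀ κ' u' κ u, |wB κ' u' κ u| ≤ CwB) (hS : LocStencil S Cs δ) (hδ : 0 < δ)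
    (κ' : Fin (d + 1)) (u' : Fin (d + 1) → ℤ) :
    push₃ lE rE wE S κ' u' - push₃ lB rB wB S κ' u'
      = (push₃ (lE - lB) rB wB S κ' u' + push₃ lB (rE - rB) wB S κ' u' + push₃ lB rB (wE - wB) S κ' u')
        + (push₃ (lE - lB) (rE - rB) wB S κ' u' + push₃ (lE - lB) rB (wE - wB) S κ' u' + push₃ lB (rE - rB) (wE - wB) S κ' u')
        + push₃ (lE - lB) (rE - rB) (wE - wB) S κ' u' := by
  -- the difference families are again in the class
  have hlD : ∀ α x' κ x, |(lE - lB) α x' κ x| ≤ ClE + ClB := fun α x' κ x => by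
    rw [Pi.sub_apply, Pi.sub_apply, Pi.sub_apply, Pi.sub_apply]
    exact (abs_sub _ _).trans (add_le_add (hlE α x' κ x) (hlB α x' κ x))
  have hlDs : ∀ α x' κ, Summable fun x => (lE - lB) α x' κ x := fun α x' κ =>
    ((hlEs α x' κ).sub (hlBs α x' κ)).congr fun x => by simp only [Pi.sub_apply]
  have hrDs : ∀ β z' κ, Summable fun z => (rE - rB) β z' κ z := fun β z' κ =>
    ((hrEs β z' κ).sub (hrBs β z' κ)).congr fun z => by simp only [Pi.sub_apply]
  have hwD : ∀ κ' u' κ u, |(wE - wB) κ' u' κ u| ≤ CwE + CwB := fun κ' u' κ u => by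
    rw [Pi.sub_apply, Pi.sub_apply, Pi.sub_apply, Pi.sub_apply]
    exact (abs_sub _ _).trans (add_le_add (hwE κ' u' κ u) (hwB κ' u' κ u))
  -- expand every difference leg (left, then right, then table) into the two readings
  rw [push₃_sub_left hlE hlEs hlB hlBs hrBs hwB hS hδ, push₃_sub_right hlB hrEs hrBs hwB hS hδ,
    push₃_sub_table hlB hlBs hrBs hwE hwB hS hδ,
    push₃_sub_left hlE hlEs hlB hlBs hrDs hwB hS hδ, push₃_sub_right hlE hrEs hrBs hwB hS hδ, push₃_sub_right hlB hrEs hrBs hwB hS hδ,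
    push₃_sub_left hlE hlEs hlB hlBs hrBs hwD hS hδ, push₃_sub_table hlE hlEs hrBs hwE hwB hS hδ,
    push₃_sub_table hlB hlBs hrBs hwE hwB hS hδ,
    push₃_sub_right hlB hrEs hrBs hwD hS hδ, push₃_sub_table hlB hlBs hrEs hwE hwB hS hδ, push₃_sub_table hlB hlBs hrBs hwE hwB hS hδ,
    push₃_sub_left hlE hlEs hlB hlBs hrDs hwD hS hδ, push₃_sub_right hlE hrEs hrBs hwD hS hδ, push₃_sub_right hlB hrEs hrBs hwD hS hδ,
    push₃_sub_table hlE hlEs hrEs hwE hwB hS hδ, push₃_sub_table hlE hlEs hrBs hwE hwB hS hδ,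
    push₃_sub_table hlB hlBs hrEs hwE hwB hS hδ, push₃_sub_table hlB hlBs hrBs hwE hwB hS hδ]
  abel

end SummableClass

/-! ## §5 The summable class from block envelopes -/

section Envelope

variable {N : ℕ} {κ₀ E : ℝ} {f : Fin (d + 1) → (Fin (d + 1) → ℤ) → Fin (d + 1) → (Fin (d + 1) → ℤ) → ℝ}

/-- [folklore] A leg family under a BLOCK ENVELOPE about its coarse label (leaf-12's `EnvelopeBlockSum` currency, `κ₀ ≥ 0`),
`|f μ y κ u| ≤ E·e^{−κ₀‖quo N u − y‖∞}`, is BOUNDED by `E`. -/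
theorem abs_le_of_env' (hκ : 0 ≤ κ₀) (hf : ∀ μ y κ u, |f μ y κ u| ≤ E * Real.exp (-(κ₀ * supNorm (quo N u - y))))
    (μ : Fin (d + 1)) (y : Fin (d + 1) → ℤ) (κ : Fin (d + 1)) (u : Fin (d + 1) → ℤ) : |f μ y κ u| ≤ E := by
  have h0 := hf μ y κ u
  have h1 := env_le_one (L := N) hκ y u
  have h2 : 0 < Real.exp (-(κ₀ * supNorm (quo N u - y))) := Real.exp_pos _
  have hE : 0 ≤ E := by
    rcases le_or_gt 0 E with h | h
    · exact h
    · exact absurd ((abs_nonneg _).trans h0) (not_le.2 (mul_neg_of_neg_of_pos h h2))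
  nlinarith

/-- [folklore] A leg family under a block envelope at a POSITIVE rate (`N ≥ 1`) has SUMMABLE fine slices. -/
theorem summable_of_env' (hN : 1 ≤ N) (hκ : 0 < κ₀) (hf : ∀ μ y κ u, |f μ y κ u| ≤ E * Real.exp (-(κ₀ * supNorm (quo N u - y))))
    (μ : Fin (d + 1)) (y : Fin (d + 1) → ℤ) (κ : Fin (d + 1)) : Summable fun u => f μ y κ u :=
  Summable.of_norm_bounded ((summable_env hN hκ y).mul_left E) (fun u => by rw [Real.norm_eq_abs]; exact hf μ y κ u)

variable {lE lB rE rB wE wB : Fin (d + 1) → (Fin (d + 1) → ℤ) → Fin (d + 1) → (Fin (d + 1) → ℤ) → ℝ}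
variable {NE NB : ℕ} {κE κB EL EL' ER ER' EW EW' Cs δ : ℝ}

/-- [folklore] **THE TELESCOPING IDENTITY FROM ENVELOPES**: all six leg families under block envelopes at positive rates (any two blockings `Nᴱ, Nᴮ ≥ 1`,
any constants), the table `LocStencil S Cs δ` with `0 < δ` ⟹ `push₃_telescope`.  (The dressed legs' envelopes are leaf-01 g57's
`DressedLegEnvelope.exists_legChain_envelope`; the undressed legs' are the one-shot response's, `RespStepDecay` / `RemainderExplicit*`.) -/
theorem push₃_telescope_of_env (hNE : 1 ≤ NE) (hNB : 1 ≤ NB) (hκE : 0 < κE) (hκB : 0 < κB)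
    (hlE : ∀ μ y κ u, |lE μ y κ u| ≤ EL * Real.exp (-(κE * supNorm (quo NE u - y))))
    (hlB : ∀ μ y κ u, |lB μ y κ u| ≤ EL' * Real.exp (-(κB * supNorm (quo NB u - y))))
    (hrE : ∀ μ y κ u, |rE μ y κ u| ≤ ER * Real.exp (-(κE * supNorm (quo NE u - y))))
    (hrB : ∀ μ y κ u, |rB μ y κ u| ≤ ER' * Real.exp (-(κB * supNorm (quo NB u - y))))
    (hwE : ∀ μ y κ u, |wE μ y κ u| ≤ EW * Real.exp (-(κE * supNorm (quo NE u - y))))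
    (hwB : ∀ μ y κ u, |wB μ y κ u| ≤ EW' * Real.exp (-(κB * supNorm (quo NB u - y))))
    (hS : LocStencil S Cs δ) (hδ : 0 < δ) (κ' : Fin (d + 1)) (u' : Fin (d + 1) → ℤ) :
    push₃ lE rE wE S κ' u' - push₃ lB rB wB S κ' u'
      = push₃ (lE - lB) rE wE S κ' u' + push₃ lB (rE - rB) wE S κ' u' + push₃ lB rB (wE - wB) S κ' u' :=
  push₃_telescope (abs_le_of_env' hκE.le hlE) (summable_of_env' hNE hκE hlE) (abs_le_of_env' hκB.le hlB) (summable_of_env' hNB hκB hlB)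
    (summable_of_env' hNE hκE hrE) (summable_of_env' hNB hκB hrB) (abs_le_of_env' hκE.le hwE) (abs_le_of_env' hκB.le hwB) hS hδ κ' u'

end Envelope

end Summit.QuantumFields.BalabanUV.Beta.GAN24.Push3LegTelescope

end
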